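import Summits.QuantumAdvantage.QuantumAdvantage.Theorems.OddPrimeWalkDesignConfig
import Summits.QuantumAdvantage.QuantumAdvantage.Theses.OddPrimeWalk

/-!
# Item stmt-QuantumAdvantage-24031 `FarDegreePairLaw` — the FAR-DEGREE PAIR LAW of the u-walk game (route OddPrimeWalk, support, rank 9)

Cell qa-qnc0; planner qa-qnc0-p2 g29 (ROUND-29 §4, THM 29-A(iii)); prover qn-prover-3 g18.

THEOREM (`oddPrimeWalk_farDegreePairLaw`).  For every `d` there are `θ_d < 1` and `m₀` (here `m₀ = gLen d = 3(d+1) + 3·2^(d+1)`,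
`θ_d = 1 − 2^(−2·gLen d)/(3(2^(d+1)−1))²`) such that: if across a separator `m` (both sides `≥ m₀` bits) every cut `g ≤ m` has
`𝔽₂`-degree `≤ d` in the bits `≥ m` and every cut `g > m` has `𝔽₂`-degree `≤ d` in the bits `< m` (filed as vanishing `(d+1)`-subcube
parities; own side arbitrary), then `#WIN ≤ θ_d·2ⁿ`.

PROOF.  `design_exists_lose` (file `OddPrimeWalkDesignConfig`) for the designs with bases `rA = extS SA gA`, `rB = extS SB gB`
parametrised by the free near bits `SA = [0, m − gLen d)` and the free far bits `SB = [m + gLen d, n)`; AVERAGING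
(`pow_le_card_lose_design`): every parameter pair has a lost slot pair, each slot pair is injective in the parameters
(`glue_inj`, `addV_right_cancel`, `extS_injective`), so `2^(m−gLen d)·2^(n−m−gLen d) ≤ |ι|²·#LOSE` by double counting; arithmetic.
WHAT THIS IS NOT: instrument — the method is intrinsically bounded-far-degree (mod-5 hyperplane indicators span all Boolean functions
over 𝔽₂, ROUND-29 §4.6) and does not touch the dense cruxes 23029/23109; the constant is not optimised; separation NOT moved.
-/

namespace Summit.QuantumAdvantage.AdviceFreeQNC0.OddConfig

open Finset Classical

variable {n : ℕ}

/-! ### §1 Injectivity of the design parametrisation -/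

/-- extension by zero is injective. -/
theorem extS_injective (S : Finset (Fin n)) : Function.Injective (extS S) := by
  intro g g' h; funext q
  have := congrFun h (S.equivFin.symm q).1
  rwa [extS_apply_symm, extS_apply_symm] at this

/-- `glue` separates a near-supported first argument and a far-supported second argument. -/
theorem glue_inj {m : ℕ} {s s' t t' : Fin n → Bool}
    (hs : ∀ k : Fin n, ¬ k.val < m → s k = false) (hs' : ∀ k : Fin n, ¬ k.val < m → s' k = false)
    (ht : ∀ k : Fin n, k.val < m → t k = false) (ht' : ∀ k : Fin n, k.val < m → t' k = false)
    (h : glue m s t = glue m s' t') : s = s' ∧ t = t' := by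
  constructor
  · funext k
    by_cases hk : k.val < m
    · have := congrFun h k; simpa [glue, hk] using this
    · rw [hs k hk, hs' k hk]
  · funext k
    by_cases hk : k.val < m
    · rw [ht k hk, ht' k hk]
    · have := congrFun h k; simpa [glue, hk] using this

/-- right cancellation of `addV`. -/
theorem addV_right_cancel {s s' v : Fin n → Bool} (h : addV s v = addV s' v) : s = s' := by
  have h2 : addV (addV s v) v = addV (addV s' v) v := by rw [h]
  rwa [addV_assoc, addV_self, addV_zeroV, addV_assoc, addV_self, addV_zeroV] at h2

/-! ### §2 Averaging over the design parametrisation -/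

section Averaging

variable {m d : ℕ} (c : ℕ) (y : Fin (n + 1) → (Fin n → Bool) → Bool)

/-- **AVERAGING.**  With the designs of `design_exists_lose` parametrised by the free near bits (below `m − gLen d`) and the
free far bits (from `m + gLen d` on), every parameter pair has a lost slot pair and each slot pair is injective in the parameters:
`2^{m − gLen d}·2^{n − m − gLen d} ≤ |ι|²·#LOSE`. -/
theorem pow_le_card_lose_design (hgm : gLen d ≤ m) (hnB : m + gLen d ≤ n)
    (hfarA : ∀ g : Fin (n + 1), g.val ≤ m → ∀ u : Fin n → Bool, ∀ S : Finset (Fin n), S.card = d + 1 →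
      (∀ i ∈ S, m ≤ i.val) →
      (S.powerset.filter fun T => y g (fun i => Bool.xor (u i) (decide (i ∈ T))) = true).card % 2 = 0)
    (hfarB : ∀ g : Fin (n + 1), m < g.val → ∀ u : Fin n → Bool, ∀ S : Finset (Fin n), S.card = d + 1 →
      (∀ i ∈ S, i.val < m) →
      (S.powerset.filter fun T => y g (fun i => Bool.xor (u i) (decide (i ∈ T))) = true).card % 2 = 0) :
    2 ^ (m - gLen d) * 2 ^ (n - (m + gLen d)) ≤
      (Fintype.card (Fin 3 × NW (d + 1)) * Fintype.card (Fin 3 × NW (d + 1))) *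
        (univ.filter fun u : Fin n → Bool => ¬ ringWinU c y u = true).card := by
  have hnA : (m - gLen d) + gLen d ≤ n := by omega
  set SA : Finset (Fin n) := ivl n 0 (m - gLen d) with hSA
  set SB : Finset (Fin n) := ivl n (m + gLen d) (n - (m + gLen d)) with hSB
  have hcA : SA.card = m - gLen d := card_ivl (by omega)
  have hcB : SB.card = n - (m + gLen d) := card_ivl (by omega)
  -- the slots and the glued points
  set slotA : ((Fin SA.card → Bool) × (Fin SB.card → Bool)) → Fin 3 × NW (d + 1) → Fin n → Bool :=
    fun x i => addV (extS SA x.1) (fsum (frame hnA i.1) i.2.1) with hslotA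
  set slotB : ((Fin SA.card → Bool) × (Fin SB.card → Bool)) → Fin 3 × NW (d + 1) → Fin n → Bool :=
    fun x j => addV (extS SB x.2) (fsum (frame hnB j.1) j.2.1) with hslotB
  set R : ((Fin SA.card → Bool) × (Fin SB.card → Bool)) → (Fin 3 × NW (d + 1)) × (Fin 3 × NW (d + 1)) → Prop :=
    fun x ij => ringWinU c y (glue m (slotA x ij.1) (slotB x ij.2)) = false with hR
  -- supports of the bases
  have hrA : ∀ (gA : Fin SA.card → Bool) (k : Fin n), extS SA gA k = true → k.val < m - gLen d := by
    intro gA k hk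
    have : k ∈ SA := by by_contra h; rw [extS_apply_not_mem _ h] at hk; exact Bool.false_ne_true hk
    rw [hSA, ivl, mem_filter] at this; omega
  have hrB : ∀ (gB : Fin SB.card → Bool) (k : Fin n), extS SB gB k = true → m + gLen d ≤ k.val := by
    intro gB k hk
    have : k ∈ SB := by by_contra h; rw [extS_apply_not_mem _ h] at hk; exact Bool.false_ne_true hk
    rw [hSB, ivl, mem_filter] at this; omega
  have hsA : ∀ (t : Fin 3) (W : Finset (Fin (d + 1))) (k : Fin n), fsum (frame hnA t) W k = true → k.val < m := by
    intro t W k hk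
    have := (fsum_supp (frame hnA t) (fun j k hk => frame_supp hnA t j k hk) W k hk).2; omega
  have hsB : ∀ (t : Fin 3) (W : Finset (Fin (d + 1))) (k : Fin n), fsum (frame hnB t) W k = true → m ≤ k.val := by
    intro t W k hk
    have := (fsum_supp (frame hnB t) (fun j k hk => frame_supp hnB t j k hk) W k hk).1; omega
  have hslotA_near : ∀ x i (k : Fin n), ¬ k.val < m → slotA x i k = false := by
    intro x i k hk
    have h1 : extS SA x.1 k = false := by
      by_contra h; have := hrA x.1 k (by simpa using h); omega
    have h2 : fsum (frame hnA i.1) i.2.1 k = false := by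
      by_contra h; have := hsA i.1 i.2.1 k (by simpa using h); omega
    simp [hslotA, addV, h1, h2]
  have hslotB_far : ∀ x j (k : Fin n), k.val < m → slotB x j k = false := by
    intro x j k hk
    have h1 : extS SB x.2 k = false := by
      by_contra h; have := hrB x.2 k (by simpa using h); omega
    have h2 : fsum (frame hnB j.1) j.2.1 k = false := by
      by_contra h; have := hsB j.1 j.2.1 k (by simpa using h); omega
    simp [hslotB, addV, h1, h2]
  -- (1) every parameter pair has a lost slot pair
  have h1 : ∀ x, 1 ≤ (univ.filter fun ij => R x ij).card := by
    intro x
    obtain ⟨i, j, hij⟩ := design_exists_lose c y hgm hnB hfarA hfarB (extS SA x.1) (extS SB x.2) (hrA x.1) (hrB x.2)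
    exact card_pos.mpr ⟨(i, j), mem_filter.mpr ⟨mem_univ _, hij⟩⟩
  -- (2) each slot pair is injective in the parameters and lands in the lost inputs
  have h2 : ∀ ij, (univ.filter fun x => R x ij).card ≤ (univ.filter fun u : Fin n → Bool => ¬ ringWinU c y u = true).card := by
    intro ij
    refine card_le_card_of_injOn (fun x => glue m (slotA x ij.1) (slotB x ij.2)) ?_ ?_
    · intro x hx
      have h := (mem_filter.mp (mem_coe.mp hx)).2
      exact mem_coe.mpr (mem_filter.mpr ⟨mem_univ _, by rw [h]; exact Bool.false_ne_true⟩)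
    · intro x _ x' _ he
      obtain ⟨ha, hb⟩ := glue_inj (hslotA_near x ij.1) (hslotA_near x' ij.1) (hslotB_far x ij.2) (hslotB_far x' ij.2) he
      exact Prod.ext (extS_injective SA (addV_right_cancel ha)) (extS_injective SB (addV_right_cancel hb))
  -- (3) double count
  calc 2 ^ (m - gLen d) * 2 ^ (n - (m + gLen d))
      = (univ : Finset ((Fin SA.card → Bool) × (Fin SB.card → Bool))).card := by
        rw [card_univ, Fintype.card_prod, Fintype.card_fun, Fintype.card_fun, Fintype.card_bool, Fintype.card_fin,
          Fintype.card_fin, hcA, hcB]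
    _ = ∑ x : (Fin SA.card → Bool) × (Fin SB.card → Bool), 1 := by rw [sum_const, smul_eq_mul, mul_one]
    _ ≤ ∑ x : (Fin SA.card → Bool) × (Fin SB.card → Bool), (univ.filter fun ij => R x ij).card := sum_le_sum fun x _ => h1 x
    _ = ∑ ij : (Fin 3 × NW (d + 1)) × (Fin 3 × NW (d + 1)), (univ.filter fun x => R x ij).card := by
        simp_rw [card_filter]; exact sum_comm
    _ ≤ ∑ ij : (Fin 3 × NW (d + 1)) × (Fin 3 × NW (d + 1)),
          (univ.filter fun u : Fin n → Bool => ¬ ringWinU c y u = true).card := sum_le_sum fun ij _ => h2 ij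
    _ = _ := by rw [sum_const, smul_eq_mul, card_univ, Fintype.card_prod]

end Averaging

/-! ### §3 The far-degree pair law -/

/-- **FAR-DEGREE PAIR LAW** (item stmt-QuantumAdvantage-24031, engine form): for every `d`, with
`θ_d = 1 − 2^{−2·gLen d}/(3(2^{d+1}−1))²` and `m₀ = gLen d`. -/
theorem farDegreePairLaw_card (d : ℕ) : ∃ θ : ℝ, θ < 1 ∧ ∃ m₀ : ℕ, ∀ n m c : ℕ,
    ∀ y : Fin (n + 1) → (Fin n → Bool) → Bool, m₀ ≤ m → m + m₀ ≤ n →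
    (∀ g : Fin (n + 1), g.val ≤ m → ∀ u : Fin n → Bool, ∀ S : Finset (Fin n), S.card = d + 1 →
      (∀ i ∈ S, m ≤ i.val) →
      (S.powerset.filter fun T => y g (fun i => Bool.xor (u i) (decide (i ∈ T))) = true).card % 2 = 0) →
    (∀ g : Fin (n + 1), m < g.val → ∀ u : Fin n → Bool, ∀ S : Finset (Fin n), S.card = d + 1 →
      (∀ i ∈ S, i.val < m) →
      (S.powerset.filter fun T => y g (fun i => Bool.xor (u i) (decide (i ∈ T))) = true).card % 2 = 0) →
    ((univ.filter fun u : Fin n → Bool => Summit.QuantumAdvantage.AdviceFreeQNC0.ringWinU c y u = true).card : ℝ)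
      ≤ θ * (2 : ℝ) ^ n := by
  set K : ℝ := ((Fintype.card (Fin 3 × NW (d + 1)) * Fintype.card (Fin 3 × NW (d + 1)) : ℕ) : ℝ) with hK
  have hKpos : 0 < K := by
    rw [hK]; have h := card_index_odd d
    have : 0 < Fintype.card (Fin 3 × NW (d + 1)) := by omega
    exact_mod_cast Nat.mul_pos this this
  have hθ : 1 - (2 : ℝ)⁻¹ ^ (2 * gLen d) / K < 1 := by
    have : (0 : ℝ) < (2 : ℝ)⁻¹ ^ (2 * gLen d) / K := by positivity
    linarith
  refine ⟨1 - (2 : ℝ)⁻¹ ^ (2 * gLen d) / K, hθ, gLen d, ?_⟩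
  intro n m c y hm hmn hA hB
  have hmain := pow_le_card_lose_design (n := n) c y hm hmn hA hB
  have hmainR : (2 : ℝ) ^ (m - gLen d) * (2 : ℝ) ^ (n - (m + gLen d))
      ≤ K * ((univ.filter fun u : Fin n → Bool => ¬ ringWinU c y u = true).card : ℝ) := by
    rw [hK]; exact_mod_cast hmain
  have htot : ((univ.filter fun u : Fin n → Bool => ringWinU c y u = true).card : ℝ)
      + ((univ.filter fun u : Fin n → Bool => ¬ ringWinU c y u = true).card : ℝ) = (2 : ℝ) ^ n := by
    have h := card_filter_add_card_filter_not (s := (univ : Finset (Fin n → Bool)))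
      (fun u : Fin n → Bool => ringWinU c y u = true)
    rw [card_univ, Fintype.card_fun, Fintype.card_bool, Fintype.card_fin] at h
    exact_mod_cast h
  have hpow : (2 : ℝ) ^ (m - gLen d) * (2 : ℝ) ^ (n - (m + gLen d)) = (2 : ℝ)⁻¹ ^ (2 * gLen d) * (2 : ℝ) ^ n := by
    have e1 : (2 : ℝ) ^ (m - gLen d) * (2 : ℝ) ^ (n - (m + gLen d)) = (2 : ℝ) ^ (n - 2 * gLen d) := by
      rw [← pow_add]; congr 1; omega
    have e2 : (2 : ℝ) ^ n = (2 : ℝ) ^ (2 * gLen d) * (2 : ℝ) ^ (n - 2 * gLen d) := by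
      rw [← pow_add]; congr 1; omega
    rw [e1, e2, ← mul_assoc, inv_pow, inv_mul_cancel₀ (by positivity), one_mul]
  rw [hpow] at hmainR
  have hlose : (2 : ℝ)⁻¹ ^ (2 * gLen d) / K * (2 : ℝ) ^ n
      ≤ ((univ.filter fun u : Fin n → Bool => ¬ ringWinU c y u = true).card : ℝ) := by
    rw [div_mul_eq_mul_div, div_le_iff₀ hKpos]; linarith
  have : ((univ.filter fun u : Fin n → Bool => ringWinU c y u = true).card : ℝ)
      ≤ (2 : ℝ) ^ n - (2 : ℝ)⁻¹ ^ (2 * gLen d) / K * (2 : ℝ) ^ n := by linarith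
  linarith [this]

end Summit.QuantumAdvantage.AdviceFreeQNC0.OddConfig

namespace Summit.QuantumAdvantage.QuantumAdvantage.Theorems

set_option linter.dupNamespace false

/-- **Item stmt-QuantumAdvantage-24031 `FarDegreePairLaw` (route OddPrimeWalk, support, rank 9; planner qa-qnc0-p2 g29 ROUND-29 §4,
THM 29-A(iii); prover qn-prover-3 g18).**  For every `d` there are `θ_d < 1` and `m₀` such that if across a separator `m`
(both sides `≥ m₀`) every cut has `𝔽₂`-degree `≤ d` in the bits of the OTHER side, then `#WIN ≤ θ_d·2ⁿ`. -/
theorem oddPrimeWalk_farDegreePairLaw : Summit.QuantumAdvantage.QuantumAdvantage.Theses.OddPrimeWalk.FarDegreePairLaw := by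
  intro d
  exact Summit.QuantumAdvantage.AdviceFreeQNC0.OddConfig.farDegreePairLaw_card d

end Summit.QuantumAdvantage.QuantumAdvantage.Theorems
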